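import Mathlib.Analysis.Calculus.Deriv.ZPow
import Literature.Analysis.Fourier.TelescopingLowPassBounds
import HarnessLib

/-!
# Symbol bounds for the telescoping pieces; the affine chain rule

Topic `Literature/Analysis/Fourier`.  Conclusion of the one-variable part of the discharge of
`GradientFRD.TorusFRD` (Buchholz, J. Funct. Anal. 275 (2018), Thm 2.3 (2.26) / Thm 2.4 (v)): the pieces
`c_k = J_{k-1} h_k` (`k ≤ N`) and `c_{N+1} = J_N/a` of `TelescopingLowPassPieces.lean` obey, for all
orders `i` and decay exponents `j`, with constants independent of `B, L, N, k, a`,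

* `exists_abs_iteratedDeriv_piece_le` :
  `a^i |c_k^{(i)}(a)| ≤ U min(1, (t_{k-1}² a/B)^{-j}) · min(t_k²/B, 1/a)`  (`1 ≤ k ≤ N`, `0 < a ≤ 2B`);
* `exists_abs_iteratedDeriv_piece_last_le` :
  `a^i |c_{N+1}^{(i)}(a)| ≤ U min(1, (t_N² a/B)^{-j}) / a`  (`N ≥ 1`, `0 < a ≤ 2B`).

In the multiplier variable `a ≍ |p|²`, `t_k ≍ L^k`, these are Buchholz's Fourier bounds (2.26)
`|∂_A^ℓ 𝒞̂_k(p)| ≤ C |p|^{-2} (|p| L^{k-1})^{-n̄}` and `≤ C L^{2k}`, for all `ℓ` (the point of Thm 2.4).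
Also: the pieces are analytic on `(0, ∞)` (`contDiffOn_piece`) and the affine chain rule
`∂_s^ℓ f(a + s b) = b^ℓ f^{(ℓ)}(a + s b)` for functions smooth on an open set
(`iteratedDeriv_comp_affine`), used for the directional derivatives `D_A^ℓ` in the direction `Ȧ`.

Everything is proved; no named facts.

## References
* S. Buchholz, *Finite range decomposition for Gaussian measures with improved regularity*,
  J. Funct. Anal. 275 (2018), Thm 2.3 (2.26), Thm 2.4 (v), App. A [Buchholz2016].
* R. Bauerschmidt, Probab. Theory Relat. Fields 157 (2013), §3.4 [Bauerschmidt2013].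
-/

noncomputable section

open Finset Polynomial
open scoped Real

namespace Literature.Analysis.Fourier

/-! ## Tools -/

/-- Leibniz bound on an open set for functions smooth there. [folklore] -/
private theorem abs_iteratedDeriv_mul_le_of_isOpen {f g : ℝ → ℝ} {U : Set ℝ} (hU : IsOpen U) {n : ℕ}
    (hf : ContDiffOn ℝ n f U) (hg : ContDiffOn ℝ n g U) {x : ℝ} (hx : x ∈ U) :
    |iteratedDeriv n (fun y => f y * g y) x| ≤
      ∑ i ∈ Finset.range (n + 1), (n.choose i : ℝ) * |iteratedDeriv i f x| * |iteratedDeriv (n - i) g x| := by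
  have h := norm_iteratedFDerivWithin_mul_le (n := n) hf hg hU.uniqueDiffOn hx le_rfl
  rw [← Real.norm_eq_abs, ← norm_iteratedFDeriv_eq_norm_iteratedDeriv, ← iteratedFDerivWithin_of_isOpen n hU hx]
  refine h.trans (le_of_eq (sum_congr rfl fun i _ => ?_))
  rw [iteratedFDerivWithin_of_isOpen i hU hx, iteratedFDerivWithin_of_isOpen (n - i) hU hx,
    norm_iteratedFDeriv_eq_norm_iteratedDeriv, norm_iteratedFDeriv_eq_norm_iteratedDeriv, Real.norm_eq_abs,
    Real.norm_eq_abs]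

/-- Polynomial functions are analytic. [folklore] -/
private theorem contDiff_polyEval (P : ℝ[X]) {n : WithTop ℕ∞} : ContDiff ℝ n (fun x => P.eval x) := by
  have h := P.contDiff_aeval (𝕜 := ℝ) n
  simpa only [Polynomial.coe_aeval_eq_eval] using h

/-- `|∂^n a^{-1}| = n!/a^{n+1}` for `a > 0`. [folklore] -/
private theorem abs_iteratedDeriv_inv (n : ℕ) {a : ℝ} (ha : 0 < a) :
    |iteratedDeriv n (fun x : ℝ => x⁻¹) a| = n.factorial / a ^ (n + 1) := by
  rw [iteratedDeriv_eq_iterate, iter_deriv_inv, abs_mul, abs_mul, abs_pow, abs_neg, abs_one, one_pow, one_mul,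
    Nat.abs_cast]
  rw [show (-1 - (n : ℤ)) = -((n + 1 : ℕ) : ℤ) by push_cast; ring, zpow_neg, zpow_natCast, abs_inv, abs_pow,
    abs_of_pos ha, div_eq_mul_inv]

/-- Absorbing powers into the decay factor: `u^i min(1, u^{-(j+i)}) ≤ min(1, u^{-j})` for `u > 0`. [folklore] -/
private theorem pow_mul_min_le {u : ℝ} (hu : 0 < u) (i j : ℕ) :
    u ^ i * min 1 (u⁻¹ ^ (j + i)) ≤ min 1 (u⁻¹ ^ j) := by
  rcases le_or_gt u 1 with h1 | h1
  · have hinv : 1 ≤ u⁻¹ := one_le_inv_iff₀.2 ⟨hu, h1⟩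
    rw [min_eq_left (one_le_pow₀ hinv), min_eq_left (one_le_pow₀ hinv), mul_one]
    exact pow_le_one₀ hu.le h1
  · have hinv : u⁻¹ ≤ 1 := inv_le_one_of_one_le₀ h1.le
    rw [min_eq_right (pow_le_one₀ (by positivity) hinv), min_eq_right (pow_le_one₀ (by positivity) hinv), pow_add,
      inv_pow, inv_pow, ← mul_assoc, mul_comm (u ^ i), mul_assoc, mul_inv_cancel₀ (by positivity), mul_one]

/-! ## The cascade factor with powers of `a` absorbed -/

/-- `a^i |J_{k-1}^{(i)}(a)| ≤ K min(1, (t_{k-1}² a/B)^{-j})` for all `k ≥ 1` (for `k = 1`, `J_0 = 1` and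
`t_0 = 2`). [cite: Buchholz2016, Thm 2.3 (2.26)] -/
theorem exists_pow_mul_abs_iteratedDeriv_cascade_pred_le (i j : ℕ) : ∃ K, 0 ≤ K ∧ ∀ B : ℝ, 0 < B → ∀ L : ℕ, 5 ≤ L →
    ∀ k : ℕ, 1 ≤ k → ∀ a : ℝ, 0 < a → a ≤ 2 * B →
      a ^ i * |iteratedDeriv i (cascade B L (k - 1)) a| ≤
        K * min 1 ((((scaleT L (k - 1) : ℝ) ^ 2 * a / B))⁻¹ ^ j) := by
  obtain ⟨K, hK0, hK⟩ := exists_abs_iteratedDeriv_cascade_le_decay i (j + i)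
  refine ⟨max K (8 ^ j), le_max_of_le_left hK0, fun B hB L hL k hk a ha0 ha => ?_⟩
  set T : ℝ := (scaleT L (k - 1) : ℝ) with hT
  have hTpos : 0 < T := by
    rw [hT]; exact_mod_cast (show 0 < scaleT L (k - 1) by have := two_le_scaleT L (k - 1); omega)
  set u : ℝ := T ^ 2 * a / B with hu
  have hupos : 0 < u := by positivity
  rcases Nat.eq_zero_or_pos (k - 1) with hk0 | hk0
  · -- `J_0 = 1`
    rw [hk0]
    have hT2 : T = 2 := by
      rw [hT, hk0]; norm_num [scaleT]
    have hu8 : u ≤ 8 := by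
      rw [hu, hT2, div_le_iff₀ hB]; linarith
    rcases Nat.eq_zero_or_pos i with hi | hi
    · subst hi
      rw [pow_zero, one_mul, iteratedDeriv_zero, cascade_zero, abs_one]
      -- `1 ≤ 8^j min(1, u^{-j})`
      have hmin : (8 : ℝ)⁻¹ ^ j ≤ min 1 (u⁻¹ ^ j) := by
        refine le_min (pow_le_one₀ (by norm_num) (by norm_num)) ?_
        exact pow_le_pow_left₀ (by norm_num) (by rw [inv_le_inv₀ (by norm_num) hupos]; exact hu8) j
      calc (1 : ℝ) = 8 ^ j * (8 : ℝ)⁻¹ ^ j := by rw [← mul_pow]; norm_num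
        _ ≤ max K (8 ^ j) * min 1 (u⁻¹ ^ j) :=
            mul_le_mul (le_max_right _ _) hmin (by positivity) (le_max_of_le_right (by positivity))
    · have h := abs_iteratedDeriv_cascade_zero_le B L i a le_rfl (fun h => by omega)
      have : a ^ i * |iteratedDeriv i (cascade B L 0) a| ≤ 0 := by
        have := mul_le_mul_of_nonneg_left h (pow_nonneg ha0.le i); simpa using this
      exact this.trans (by positivity)
  · have h := hK B hB L hL (k - 1) hk0 a ha0 ha
    rw [← hT] at h
    calc a ^ i * |iteratedDeriv i (cascade B L (k - 1)) a| ≤ a ^ i * (K * (T ^ 2 / B) ^ i * min 1 (u⁻¹ ^ (j + i))) :=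
          mul_le_mul_of_nonneg_left h (by positivity)
      _ = K * ((T ^ 2 / B * a) ^ i * min 1 (u⁻¹ ^ (j + i))) := by rw [mul_pow]; ring
      _ = K * (u ^ i * min 1 (u⁻¹ ^ (j + i))) := by rw [hu, div_mul_eq_mul_div]
      _ ≤ K * min 1 (u⁻¹ ^ j) := mul_le_mul_of_nonneg_left (pow_mul_min_le hupos i j) hK0
      _ ≤ max K (8 ^ j) * min 1 (u⁻¹ ^ j) := mul_le_mul_of_nonneg_right (le_max_left _ _) (by positivity)

/-! ## The pieces `c_k`, `k ≤ N` -/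

/-- For `k ≤ N` the piece is the smooth function `J_{k-1} · h_k`. [cite: Buchholz2016, §3 (p. 9)] -/
theorem piece_eq_fun {B : ℝ} {L N k : ℕ} (hk : k ≤ N) :
    piece B L N k = fun a => cascade B L (k - 1) a * (quot B L k).eval a := by
  funext a; rw [piece, if_pos hk]

/-- **Symbol bound for the pieces `c_k`, `1 ≤ k ≤ N`**: for all `i, j` there is `U` with
`a^i |c_k^{(i)}(a)| ≤ U min(1, (t_{k-1}² a/B)^{-j}) min(t_k²/B, 1/a)` for `B > 0`, `L ≥ 5`, `0 < a ≤ 2B`.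
[cite: Buchholz2016, Thm 2.3 (2.26)] -/
theorem exists_abs_iteratedDeriv_piece_le (i j : ℕ) : ∃ U, 0 ≤ U ∧ ∀ B : ℝ, 0 < B → ∀ L : ℕ, 5 ≤ L →
    ∀ N k : ℕ, 1 ≤ k → k ≤ N → ∀ a : ℝ, 0 < a → a ≤ 2 * B →
      a ^ i * |iteratedDeriv i (piece B L N k) a| ≤
        U * min 1 ((((scaleT L (k - 1) : ℝ) ^ 2 * a / B))⁻¹ ^ j) * min ((scaleT L k : ℝ) ^ 2 / B) (1 / a) := by
  have hJ : ∀ i₁ : ℕ, ∃ K, 0 ≤ K ∧ ∀ B : ℝ, 0 < B → ∀ L : ℕ, 5 ≤ L → ∀ k : ℕ, 1 ≤ k → ∀ a : ℝ, 0 < a → a ≤ 2 * B →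
      a ^ i₁ * |iteratedDeriv i₁ (cascade B L (k - 1)) a| ≤ K * min 1 ((((scaleT L (k - 1) : ℝ) ^ 2 * a / B))⁻¹ ^ j) :=
    fun i₁ => exists_pow_mul_abs_iteratedDeriv_cascade_pred_le i₁ j
  choose K hK0 hK using hJ
  have hQ : ∀ i₂ : ℕ, ∃ H, 0 ≤ H ∧ ∀ B : ℝ, 0 < B → ∀ L k : ℕ, ∀ a : ℝ, 0 < a → a ≤ 2 * B →
      a ^ i₂ * |iteratedDeriv i₂ (fun x => (quot B L k).eval x) a| ≤ H * min ((scaleT L k : ℝ) ^ 2 / B) (1 / a) :=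
    fun i₂ => exists_abs_iteratedDeriv_quot_le i₂
  choose H hH0 hH using hQ
  set U : ℝ := ∑ i₁ ∈ Finset.range (i + 1), (i.choose i₁ : ℝ) * K i₁ * H (i - i₁) with hU
  refine ⟨U, sum_nonneg fun i₁ _ => by have := hK0 i₁; have := hH0 (i - i₁); positivity,
    fun B hB L hL N k hk1 hk a ha0 ha => ?_⟩
  rw [piece_eq_fun hk]
  have hLeib := abs_iteratedDeriv_mul_le_of_isOpen isOpen_univ (n := i)
    ((contDiff_cascade B L (k - 1) i).contDiffOn) ((contDiff_quot B L k i).contDiffOn) (Set.mem_univ a)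
  set D : ℝ := min 1 ((((scaleT L (k - 1) : ℝ) ^ 2 * a / B))⁻¹ ^ j) with hD
  set E : ℝ := min ((scaleT L k : ℝ) ^ 2 / B) (1 / a) with hE
  have hD0 : 0 ≤ D := le_min zero_le_one (by positivity)
  have hE0 : 0 ≤ E := le_min (by positivity) (by positivity)
  calc a ^ i * |iteratedDeriv i (fun y => cascade B L (k - 1) y * (quot B L k).eval y) a|
      ≤ a ^ i * ∑ i₁ ∈ Finset.range (i + 1), (i.choose i₁ : ℝ) * |iteratedDeriv i₁ (cascade B L (k - 1)) a| *
          |iteratedDeriv (i - i₁) (fun x => (quot B L k).eval x) a| :=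
        mul_le_mul_of_nonneg_left hLeib (by positivity)
    _ = ∑ i₁ ∈ Finset.range (i + 1), (i.choose i₁ : ℝ) * (a ^ i₁ * |iteratedDeriv i₁ (cascade B L (k - 1)) a|) *
          (a ^ (i - i₁) * |iteratedDeriv (i - i₁) (fun x => (quot B L k).eval x) a|) := by
        rw [Finset.mul_sum]
        refine sum_congr rfl fun i₁ hi₁ => ?_
        rw [Finset.mem_range] at hi₁
        have : a ^ i = a ^ i₁ * a ^ (i - i₁) := by rw [← pow_add, show i₁ + (i - i₁) = i by omega]
        rw [this]; ring
    _ ≤ ∑ i₁ ∈ Finset.range (i + 1), (i.choose i₁ : ℝ) * (K i₁ * D) * (H (i - i₁) * E) := by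
        refine sum_le_sum fun i₁ _ => ?_
        have h1 := hK i₁ B hB L hL k hk1 a ha0 ha
        have h2 := hH (i - i₁) B hB L k a ha0 ha
        rw [← hD] at h1
        rw [← hE] at h2
        exact mul_le_mul (mul_le_mul_of_nonneg_left h1 (Nat.cast_nonneg _)) h2 (by positivity)
          (by have := hK0 i₁; positivity)
    _ = U * D * E := by rw [hU, Finset.sum_mul, Finset.sum_mul]; exact sum_congr rfl fun i₁ _ => by ring

/-! ## The last piece `c_{N+1} = J_N/a` -/

/-- The last piece as a function: `J_N · a^{-1}`. [cite: Buchholz2016, Thm 2.3] -/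
theorem piece_last_eq_fun (B : ℝ) (L N : ℕ) : piece B L N (N + 1) = fun a => cascade B L N a * a⁻¹ := by
  funext a; rw [piece_last, div_eq_mul_inv]

/-- **Symbol bound for the last piece**: for all `i, j` there is `U` with
`a^i |c_{N+1}^{(i)}(a)| ≤ U min(1, (t_N² a/B)^{-j}) / a` for `B > 0`, `L ≥ 5`, `N ≥ 1`, `0 < a ≤ 2B`.
[cite: Buchholz2016, Thm 2.3 (2.26)] -/
theorem exists_abs_iteratedDeriv_piece_last_le (i j : ℕ) : ∃ U, 0 ≤ U ∧ ∀ B : ℝ, 0 < B → ∀ L : ℕ, 5 ≤ L →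
    ∀ N : ℕ, 1 ≤ N → ∀ a : ℝ, 0 < a → a ≤ 2 * B →
      a ^ i * |iteratedDeriv i (piece B L N (N + 1)) a| ≤ U * min 1 ((((scaleT L N : ℝ) ^ 2 * a / B))⁻¹ ^ j) / a := by
  have hJ : ∀ i₁ : ℕ, ∃ K, 0 ≤ K ∧ ∀ B : ℝ, 0 < B → ∀ L : ℕ, 5 ≤ L → ∀ k : ℕ, 1 ≤ k → ∀ a : ℝ, 0 < a → a ≤ 2 * B →
      a ^ i₁ * |iteratedDeriv i₁ (cascade B L (k - 1)) a| ≤ K * min 1 ((((scaleT L (k - 1) : ℝ) ^ 2 * a / B))⁻¹ ^ j) :=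
    fun i₁ => exists_pow_mul_abs_iteratedDeriv_cascade_pred_le i₁ j
  choose K hK0 hK using hJ
  set U : ℝ := ∑ i₁ ∈ Finset.range (i + 1), (i.choose i₁ : ℝ) * K i₁ * (i - i₁).factorial with hU
  refine ⟨U, sum_nonneg fun i₁ _ => by have := hK0 i₁; positivity, fun B hB L hL N hN a ha0 ha => ?_⟩
  rw [piece_last_eq_fun]
  have hopen : IsOpen (Set.Ioi (0 : ℝ)) := isOpen_Ioi
  have hLeib := abs_iteratedDeriv_mul_le_of_isOpen hopen (n := i) ((contDiff_cascade B L N i).contDiffOn)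
    ((contDiffOn_inv ℝ).mono fun x hx => ne_of_gt hx) (show a ∈ Set.Ioi 0 from ha0)
  set D : ℝ := min 1 ((((scaleT L N : ℝ) ^ 2 * a / B))⁻¹ ^ j) with hD
  have hD0 : 0 ≤ D := le_min zero_le_one (by positivity)
  -- `J_N = J_{(N+1)-1}`
  have hK' : ∀ i₁, a ^ i₁ * |iteratedDeriv i₁ (cascade B L N) a| ≤ K i₁ * D := by
    intro i₁
    have h := hK i₁ B hB L hL (N + 1) (by omega) a ha0 ha
    rw [Nat.add_sub_cancel] at h
    exact h
  calc a ^ i * |iteratedDeriv i (fun y => cascade B L N y * y⁻¹) a|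
      ≤ a ^ i * ∑ i₁ ∈ Finset.range (i + 1), (i.choose i₁ : ℝ) * |iteratedDeriv i₁ (cascade B L N) a| *
          |iteratedDeriv (i - i₁) (fun x : ℝ => x⁻¹) a| := mul_le_mul_of_nonneg_left hLeib (by positivity)
    _ = ∑ i₁ ∈ Finset.range (i + 1), (i.choose i₁ : ℝ) * (a ^ i₁ * |iteratedDeriv i₁ (cascade B L N) a|) *
          (a ^ (i - i₁) * |iteratedDeriv (i - i₁) (fun x : ℝ => x⁻¹) a|) := by
        rw [Finset.mul_sum]
        refine sum_congr rfl fun i₁ hi₁ => ?_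
        rw [Finset.mem_range] at hi₁
        have : a ^ i = a ^ i₁ * a ^ (i - i₁) := by rw [← pow_add, show i₁ + (i - i₁) = i by omega]
        rw [this]; ring
    _ ≤ ∑ i₁ ∈ Finset.range (i + 1), (i.choose i₁ : ℝ) * (K i₁ * D) * ((i - i₁).factorial / a) := by
        refine sum_le_sum fun i₁ _ => ?_
        have h2 : a ^ (i - i₁) * |iteratedDeriv (i - i₁) (fun x : ℝ => x⁻¹) a| = (i - i₁).factorial / a := by
          rw [abs_iteratedDeriv_inv (i - i₁) ha0, pow_succ]; field_simp
        rw [h2]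
        exact mul_le_mul_of_nonneg_right (mul_le_mul_of_nonneg_left (hK' i₁) (Nat.cast_nonneg _)) (by positivity)
    _ = U * D / a := by
        rw [hU, Finset.sum_mul, Finset.sum_div]; exact sum_congr rfl fun i₁ _ => by ring

/-! ## Crude forms used for the Fourier bounds -/

/-- `min(t_k²/B, 1/a) ≤ L^{2k}/(4B)` (`L ≥ 5`, `k ≥ 1`). [cite: Buchholz2016, Thm 2.3 (2.26), case |p| ≤ L^{-k}] -/
theorem min_scale_le {B : ℝ} (hB : 0 < B) {L : ℕ} (hL : 5 ≤ L) {k : ℕ} (hk : 1 ≤ k) (a : ℝ) :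
    min ((scaleT L k : ℝ) ^ 2 / B) (1 / a) ≤ (L : ℝ) ^ (2 * k) / (4 * B) := by
  refine (min_le_left _ _).trans ?_
  have h := scaleT_le L k (by omega) hk
  have h0 : (0 : ℝ) ≤ scaleT L k := Nat.cast_nonneg _
  rw [div_le_div_iff₀ hB (by positivity)]
  have : (scaleT L k : ℝ) ^ 2 ≤ (L : ℝ) ^ (2 * k) / 4 := by
    calc (scaleT L k : ℝ) ^ 2 ≤ ((L : ℝ) ^ k / 2) ^ 2 := pow_le_pow_left₀ h0 h 2
      _ = (L : ℝ) ^ (2 * k) / 4 := by rw [div_pow, ← pow_mul, mul_comm]; norm_num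
  calc (scaleT L k : ℝ) ^ 2 * (4 * B) ≤ (L : ℝ) ^ (2 * k) / 4 * (4 * B) := by gcongr
    _ = (L : ℝ) ^ (2 * k) * B := by ring

/-- The decay factor in terms of a lower bound `t ≥ T`: `min(1, (t² a/B)^{-j}) ≤ min(1, (T² a/B)^{-j})` for
`0 < T ≤ t`. [cite: Buchholz2016, Thm 2.3 (2.26)] -/
theorem min_decay_mono {B a T t : ℝ} (hB : 0 < B) (ha : 0 < a) (hT : 0 < T) (hTt : T ≤ t) (j : ℕ) :
    min 1 (((t ^ 2 * a / B))⁻¹ ^ j) ≤ min 1 (((T ^ 2 * a / B))⁻¹ ^ j) := by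
  have ht : 0 < t := lt_of_lt_of_le hT hTt
  refine min_le_min le_rfl (pow_le_pow_left₀ (by positivity) ?_ j)
  rw [inv_le_inv₀ (by positivity) (by positivity)]
  gcongr

/-! ## Analyticity of the pieces and the affine chain rule -/

/-- The pieces are analytic on `(0, ∞)` (polynomials for `k ≤ N`, `J_N/a` for `k = N+1`).
[cite: Buchholz2016, Thm 2.4 ("real analytic for k = N+1")] -/
theorem contDiffOn_piece (B : ℝ) (L N k : ℕ) {n : WithTop ℕ∞} : ContDiffOn ℝ n (piece B L N k) (Set.Ioi 0) := by
  by_cases hk : k ≤ N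
  · rw [piece_eq_fun hk]
    have h1 : ContDiff ℝ n (cascade B L (k - 1)) := by
      have : cascade B L (k - 1) = fun a => (cascadePoly B L (k - 1)).eval a :=
        funext fun a => (cascadePoly_eval B L (k - 1) a).symm
      rw [this]; exact contDiff_polyEval _
    exact (h1.mul (contDiff_polyEval _)).contDiffOn
  · have hk' : k = N + 1 ∨ N + 1 < k := by omega
    have hfun : piece B L N k = fun a => cascade B L N a * a⁻¹ := by
      funext a; rw [piece, if_neg hk, div_eq_mul_inv]
    rw [hfun]
    have h1 : ContDiff ℝ n (cascade B L N) := by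
      have : cascade B L N = fun a => (cascadePoly B L N).eval a := funext fun a => (cascadePoly_eval B L N a).symm
      rw [this]; exact contDiff_polyEval _
    exact h1.contDiffOn.mul ((contDiffOn_inv ℝ).mono fun x hx => ne_of_gt hx)

/-- **Affine chain rule** for functions smooth on an open set: if `f` is `C^∞` on an open `U` and
`a + s b ∈ U`, then `∂_s^ℓ [f(a + s b)] = b^ℓ f^{(ℓ)}(a + s b)`. [cite: Buchholz2016, App. A (A.9)–(A.10) (D_A^ℓ)] -/
theorem iteratedDeriv_comp_affine {f : ℝ → ℝ} {U : Set ℝ} (hU : IsOpen U) (hf : ContDiffOn ℝ ⊤ f U) (a b : ℝ) :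
    ∀ (ℓ : ℕ) (s : ℝ), a + s * b ∈ U →
      iteratedDeriv ℓ (fun s => f (a + s * b)) s = b ^ ℓ * iteratedDeriv ℓ f (a + s * b) := by
  intro ℓ
  induction ℓ with
  | zero => intro s _; simp
  | succ ℓ ih =>
    intro s hs
    -- the set of good parameters is open
    have hV : IsOpen {s : ℝ | a + s * b ∈ U} := hU.preimage (by fun_prop)
    have hVs : {s : ℝ | a + s * b ∈ U} ∈ nhds s := hV.mem_nhds hs
    have hev : (iteratedDeriv ℓ fun s => f (a + s * b)) =ᶠ[nhds s] fun s => b ^ ℓ * iteratedDeriv ℓ f (a + s * b) := by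
      filter_upwards [hVs] with s' hs' using ih s' hs'
    rw [iteratedDeriv_succ, hev.deriv_eq]
    -- differentiability of `iteratedDeriv ℓ f` at `a + s b`
    have hdiffU : DifferentiableOn ℝ (iteratedDeriv ℓ f) U := by
      have h1 : DifferentiableOn ℝ (iteratedDerivWithin ℓ f U) U :=
        hf.differentiableOn_iteratedDerivWithin (WithTop.coe_lt_top _) hU.uniqueDiffOn
      exact h1.congr fun x hx => (iteratedDerivWithin_of_isOpen hU hx).symm
    have hdiff : DifferentiableAt ℝ (iteratedDeriv ℓ f) (a + s * b) := hdiffU.differentiableAt (hU.mem_nhds hs)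
    have hφ : HasDerivAt (fun s : ℝ => a + s * b) b s := by
      have := ((hasDerivAt_id s).mul_const b).const_add a
      simpa using this
    have hcomp : HasDerivAt (fun s : ℝ => iteratedDeriv ℓ f (a + s * b)) (iteratedDeriv (ℓ + 1) f (a + s * b) * b) s := by
      have h := hdiff.hasDerivAt.comp s hφ
      rw [iteratedDeriv_succ]
      exact h
    have hfin : HasDerivAt (fun s : ℝ => b ^ ℓ * iteratedDeriv ℓ f (a + s * b))
        (b ^ ℓ * (iteratedDeriv (ℓ + 1) f (a + s * b) * b)) s := hcomp.const_mul _
    rw [hfin.deriv, pow_succ]; ring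

end Literature.Analysis.Fourier

end
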